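import Summits.AtomisticToContinuum.Crystallization.Theorems.FrustratedLawDichotomyStrainedPatchHomForceCentredVerdict
import Summits.AtomisticToContinuum.Crystallization.Theorems.FrustratedLawDichotomyStrainedPatchHomForceHcp

/-!
# (C′-2) FORCE/EXEMPT PRUNE, centred form — the hcp VERDICT with the CENTRED exempt prune and `(H) HomFloor m` re-booked over it
# (27623 strained-patch piece, hcp half; decomp-a2c hand-2 g28; centred twin of `…HomForceHcp`)

`…HomForceHcp` books `(H)`-hcp over `entryLeafOKHX := forceOut ∨ entryLeafOKHQ μ` with the v1 (naive-interval) force leaf, which closes only at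
half-width `≲ 2⁻¹²`.  This module is the same plumbing over the CENTRED certificate-free leaf `…HomForceCentred.forceOutC0` (closes at `(2⁻⁹, 2⁻¹⁰)` on
the Finding-A box, `…HomForceCentredPilot`), with the QUICK verdict evaluated FIRST (the force menu runs only where `entryLeafOKHQ` fails):

* §1 `forceMenuC` (eight rational directions, step `10⁻⁶`), ★ `forceOutCM c w := xiBallOK c w ∧ forceMenuC c w`, `forceOutCM_sound` (`hver` shape);
* §2 ★★ `entryLeafOKHC μ := entryLeafOKHQ μ ∨ forceOutCM`, `entryLeafOKHC_sound`, ★★ `hcpHalf_of_entryTreeHC`,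
  ★★★ `homFloor_of_entryTrees6RBKP_HC` / `homFloor_625_of_entryTrees6RBKP_HC` — `(H) HomFloor m` from the fcc ∃-tree fact of record and an hcp
  ∃-tree fact over the centred verdict.
Definitions computable; 0 sorry; axioms standard; no instances / notation.  `--supports stmt-AtomisticToContinuum-27623`.
-/

namespace Summit.AtomisticToContinuum.Crystallization.Theorems.FrustratedLawDichotomyStrainedPatchHomForceCentredHcp

open scoped BigOperators RealInnerProductSpace
open Literature.Analysis.ValidatedNumerics.Numerics
open Summit.AtomisticToContinuum.Crystallization.Theorems.ChargedEnergyGapNegative (E3)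
open Summit.AtomisticToContinuum.Crystallization.Theorems.FrustratedLawDichotomySchurCut (effPot w₄₅ ω₄)
open Summit.AtomisticToContinuum.Crystallization.Theorems.FrustratedLawDichotomyAveragingRuleTightFree (TightNearCap BadNearCap)
open Summit.AtomisticToContinuum.Crystallization.Theorems.FrustratedLawDichotomyExemptAbsorption (ExemptNear)
open Summit.AtomisticToContinuum.Crystallization.Theorems.FrustratedLawDichotomyStrainedPatchHomSplit
open Summit.AtomisticToContinuum.Crystallization.Theorems.FrustratedLawDichotomyStrainedPatchHomPrunedPolar (homFloor_of_prunedBoxSums_selfAdjoint)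
open Summit.AtomisticToContinuum.Crystallization.Theorems.FrustratedLawDichotomyStrainedPatchHomCertTree (CertTree treeOK)
open Summit.AtomisticToContinuum.Crystallization.Theorems.FrustratedLawDichotomyStrainedPatchHomEntryGram (rootC rootW)
open Summit.AtomisticToContinuum.Crystallization.Theorems.FrustratedLawDichotomyStrainedPatchHomEntryGramHcp (rootCH rootWH)
open Summit.AtomisticToContinuum.Crystallization.Theorems.FrustratedLawDichotomyStrainedPatchHomEntryTable (muRec muRec_ok)
open Summit.AtomisticToContinuum.Crystallization.Theorems.FrustratedLawDichotomyStrainedPatchHomEntryFlipHcp (HcpDich hcpHalf_of_entryTreeShuf)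
open Summit.AtomisticToContinuum.Crystallization.Theorems.FrustratedLawDichotomyStrainedPatchHomEntryTableP (entryLeafOK6RBKP)
open Summit.AtomisticToContinuum.Crystallization.Theorems.FrustratedLawDichotomyStrainedPatchHomLeafTableCheckHcpV (entryLeafOKHVK_sound)
open Summit.AtomisticToContinuum.Crystallization.Theorems.FrustratedLawDichotomyStrainedPatchHomEntryQuickHcp (entryLeafOKHQ entryLeafOKHQ_imp)
open Summit.AtomisticToContinuum.Crystallization.Theorems.FrustratedLawDichotomyStrainedPatchHomEntryTreeCert (fccHalf_of_entryTree6RBKP)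
open Summit.AtomisticToContinuum.Crystallization.Theorems.FrustratedLawDichotomyStrainedPatchHomForceHcp (xiBallOK norm_le_quarter_of_xiBallOK)
open Summit.AtomisticToContinuum.Crystallization.Theorems.FrustratedLawDichotomyStrainedPatchHomForceCentred (forceOutC0)
open Summit.AtomisticToContinuum.Crystallization.Theorems.FrustratedLawDichotomyStrainedPatchHomForceCentredFinal (forceOutC0_sound)

/-! ## §1. The direction menu over the centred leaf -/

/-- The eight move directions (rational, at most unit): `±x̂`, `±(½, √3/2)`, `±(−½, √3/2)` as `(±500, ±866, 0)/1000`, `±ẑ`; step `s = 10⁻⁶`;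
each evaluated by the certificate-free centred leaf `forceOutC0`. -/
def forceMenuC (c w : (Fin 3 × Fin 3) ⊕ Fin 3 → ℤ) : Bool :=
  forceOutC0 ![1, 0, 0] 1 1 1000000 c w || forceOutC0 ![-1, 0, 0] 1 1 1000000 c w ||
  forceOutC0 ![500, 866, 0] 1000 1 1000000 c w || forceOutC0 ![-500, -866, 0] 1000 1 1000000 c w ||
  forceOutC0 ![-500, 866, 0] 1000 1 1000000 c w || forceOutC0 ![500, -866, 0] 1000 1 1000000 c w ||
  forceOutC0 ![0, 0, 1] 1 1 1000000 c w || forceOutC0 ![0, 0, -1] 1 1 1000000 c w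

/-- ★ **`forceOutCM`** — the centred force/exempt prune verdict on an entry/shuffle box: box inside the quarter ball and some menu direction fires. -/
def forceOutCM (c w : (Fin 3 × Fin 3) ⊕ Fin 3 → ℤ) : Bool := xiBallOK c w && forceMenuC c w

/-- ★ **SOUNDNESS OF `forceOutCM` IN THE `hver` SHAPE** (prune disjunct, middle alternative). [folklore] -/
theorem forceOutCM_sound {μ : ℤ} {c w : (Fin 3 × Fin 3) ⊕ Fin 3 → ℤ} (h : forceOutCM c w = true) (U : E3 →L[ℝ] E3) (ξ : E3)
    (_hsa : ∀ v v' : E3, ⟪U v, v'⟫ = ⟪v, U v'⟫) (hU : ‖U - 1‖ ≤ 1 / 4)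
    (hbox : ∀ ab : Fin 3 × Fin 3, |(U (EuclideanSpace.single ab.2 (1 : ℝ))) ab.1 - (c (Sum.inl ab) : ℝ) / SC| ≤ (w (Sum.inl ab) : ℝ) / SC)
    (hξ : ∀ i : Fin 3, |ξ i - (c (Sum.inr i) : ℝ) / SC| ≤ (w (Sum.inr i) : ℝ) / SC) (_h0 : 0 ≤ ξ 0) (_h2 : 0 ≤ ξ 2) :
    (∀ (M : ℕ) (z : Fin M → E3) (cc : Fin M), Function.Injective z →
        Set.range z = {x : E3 | dist x (z cc) ≤ 133 / 10 ∧ ∃ a : Fin 3 → ℤ,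
          x = z cc + latPt U hexFrame a ∨ x = z cc + latPt U hexFrame a + U (hcpShift + ξ)} →
        TightNearCap (9 / 5) (3 / 2) z cc ∨ ExemptNear (9 / 5) ExRec z cc ∨ BadNearCap (9 / 5) (3 / 2) z cc) ∨
      (μ : ℝ) / SC ≤ ∑ b ∈ (Fintype.piFinset fun _ : Fin 3 => Finset.Icc (-7 : ℤ) 7).filter (fun b => b ≠ 0), effPot w₄₅ ω₄ (3 / 400) ‖latPt U hexFrame b‖ +
        ∑ b ∈ (Fintype.piFinset fun _ : Fin 3 => Finset.Icc (-7 : ℤ) 7), effPot w₄₅ ω₄ (3 / 400) ‖latPt U hexFrame b + U (hcpShift + ξ)‖ := by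
  simp only [forceOutCM, Bool.and_eq_true] at h
  obtain ⟨hball, hmenu⟩ := h
  have hξn := norm_le_quarter_of_xiBallOK hball hξ
  left
  simp only [forceMenuC, Bool.or_eq_true] at hmenu
  rcases hmenu with ((((((h | h) | h) | h) | h) | h) | h) | h <;> exact forceOutC0_sound h U ξ hU hξn hbox hξ

/-! ## §2. The verdict (quick verdict first, then the centred exempt prune) and `(H) HomFloor m` -/

/-- ★★ **THE hcp VERDICT WITH THE CENTRED EXEMPT PRUNE**: `entryLeafOKHQ μ ∨ forceOutCM` (quick verdict first). -/
def entryLeafOKHC (μ : ℤ) (c w : (Fin 3 × Fin 3) ⊕ Fin 3 → ℤ) : Bool := entryLeafOKHQ μ c w || forceOutCM c w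

/-- ★★ Soundness of `entryLeafOKHC` in the `hver` shape. [folklore] -/
theorem entryLeafOKHC_sound {μ : ℤ} {c w : (Fin 3 × Fin 3) ⊕ Fin 3 → ℤ} (h : entryLeafOKHC μ c w = true) (U : E3 →L[ℝ] E3) (ξ : E3)
    (hsa : ∀ v v' : E3, ⟪U v, v'⟫ = ⟪v, U v'⟫) (hU : ‖U - 1‖ ≤ 1 / 4)
    (hbox : ∀ ab : Fin 3 × Fin 3, |(U (EuclideanSpace.single ab.2 (1 : ℝ))) ab.1 - (c (Sum.inl ab) : ℝ) / SC| ≤ (w (Sum.inl ab) : ℝ) / SC)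
    (hξ : ∀ i : Fin 3, |ξ i - (c (Sum.inr i) : ℝ) / SC| ≤ (w (Sum.inr i) : ℝ) / SC) (h0 : 0 ≤ ξ 0) (h2 : 0 ≤ ξ 2) :
    (∀ (M : ℕ) (z : Fin M → E3) (cc : Fin M), Function.Injective z →
        Set.range z = {x : E3 | dist x (z cc) ≤ 133 / 10 ∧ ∃ a : Fin 3 → ℤ,
          x = z cc + latPt U hexFrame a ∨ x = z cc + latPt U hexFrame a + U (hcpShift + ξ)} →
        TightNearCap (9 / 5) (3 / 2) z cc ∨ ExemptNear (9 / 5) ExRec z cc ∨ BadNearCap (9 / 5) (3 / 2) z cc) ∨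
      (μ : ℝ) / SC ≤ ∑ b ∈ (Fintype.piFinset fun _ : Fin 3 => Finset.Icc (-7 : ℤ) 7).filter (fun b => b ≠ 0), effPot w₄₅ ω₄ (3 / 400) ‖latPt U hexFrame b‖ +
        ∑ b ∈ (Fintype.piFinset fun _ : Fin 3 => Finset.Icc (-7 : ℤ) 7), effPot w₄₅ ω₄ (3 / 400) ‖latPt U hexFrame b + U (hcpShift + ξ)‖ := by
  simp only [entryLeafOKHC, Bool.or_eq_true] at h
  rcases h with h | h
  · exact entryLeafOKHVK_sound (entryLeafOKHQ_imp μ c w h) U ξ hsa hU hbox hξ h0 h2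
  · exact forceOutCM_sound (μ := μ) h U ξ hsa hU hbox hξ h0 h2

/-- ★★ The hcp half from ONE certificate tree over the verdict with the CENTRED exempt prune. [folklore] -/
theorem hcpHalf_of_entryTreeHC {m : ℝ} {μ : ℤ} (hμ : 2 * (m + (-(7175 / 10000) + 3 / 400)) * SC ≤ μ) {t : CertTree ((Fin 3 × Fin 3) ⊕ Fin 3)}
    (h : treeOK (entryLeafOKHC μ) t rootCH rootWH = true) :
    ∀ (U : E3 →L[ℝ] E3) (ξ : E3), (∀ v w : E3, inner ℝ (U v) w = inner ℝ v (U w)) → (∀ w : E3, 0 ≤ inner ℝ w (U w)) →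
      ‖U - 1‖ ≤ 1 / 4 → ‖ξ‖ ≤ 1 / 4 → HcpDich m U ξ :=
  hcpHalf_of_entryTreeShuf hμ (entryLeafOKHC μ) (fun _ _ hv U ξ hsa hU hbox hξ h0 h2 => entryLeafOKHC_sound hv U ξ hsa hU hbox hξ h0 h2) h

/-- ★★★ **`(H) HomFloor m` over the CENTRED verdict**: the fcc ∃-tree fact of record (`entryLeafOK6RBKP μ`) and an hcp ∃-tree fact over
`entryLeafOKHC μ` give `HomFloor m`, every `m`, `μ` with `2(m + e_W)SC ≤ μ`. [folklore] -/
theorem homFloor_of_entryTrees6RBKP_HC {m : ℝ} {μ : ℤ} (hμ : 2 * (m + (-(7175 / 10000) + 3 / 400)) * SC ≤ μ)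
    (hF : ∃ t : CertTree (Fin 3 × Fin 3), treeOK (entryLeafOK6RBKP μ) t rootC rootW = true)
    (hH : ∃ t : CertTree ((Fin 3 × Fin 3) ⊕ Fin 3), treeOK (entryLeafOKHC μ) t rootCH rootWH = true) : HomFloor m := by
  obtain ⟨tF, htF⟩ := hF
  obtain ⟨tH, htH⟩ := hH
  exact homFloor_of_prunedBoxSums_selfAdjoint (fccHalf_of_entryTree6RBKP hμ htF) (hcpHalf_of_entryTreeHC hμ htH)

/-- ★★★ **`(H) HomFloor (1/625)` over the CENTRED verdict** (`μ = muRec`). [folklore] -/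
theorem homFloor_625_of_entryTrees6RBKP_HC
    (hF : ∃ t : CertTree (Fin 3 × Fin 3), treeOK (entryLeafOK6RBKP muRec) t rootC rootW = true)
    (hH : ∃ t : CertTree ((Fin 3 × Fin 3) ⊕ Fin 3), treeOK (entryLeafOKHC muRec) t rootCH rootWH = true) : HomFloor (1 / 625) :=
  homFloor_of_entryTrees6RBKP_HC muRec_ok hF hH

end Summit.AtomisticToContinuum.Crystallization.Theorems.FrustratedLawDichotomyStrainedPatchHomForceCentredHcp
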